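import Literature.MathematicalPhysics.QuantumFieldTheory.Balaban1983to89.B2Eq224FirstStepFields
import Literature.MathematicalPhysics.QuantumFieldTheory.Balaban1983to89.B2Lemma25Proof

/-!
# `Balaban1983to89.B2Eq236Replacements` — [Balaban1982Higgs2] (2.36) p. 565 (part 1 of the vector-field replacements
(2.36)–(2.37) turning the second representation (2.34) of `ρ″^{(1),L}` into the density `ρ^{(1),L}`; part 2 = (2.37) is
`…B2Eq237FormSplit`) — the exact part PROVED and the `O(ε^κ)|∂Λ₅|` error PROVED from the Proposition I.2.3 decay shape
(I.2.34) + the separation of (2.8), with *"arbitrary κ"* from `…B2StepK.rDecayBeatsPowers`; plus the two bilinear decay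
engines both parts run on

statement-level skeleton of published theorems with citation tags; proofs where landed; nothing here is a claim about the Yang–Mills mass gap

PDF held: `paper:balaban1982-cmp86-higgs23-ii` (T. Bałaban, *(Higgs)₂,₃ quantum fields in a finite volume. II. An upper
bound*, Commun. Math. Phys. **86** (1982) 555–594, doi 10.1007/bf01214890; journal page = PDF page + 554); p. 565 [PDF 11]
READ AS AN IMAGE on the ×2 render
`run/shared/lean/pub/pub-balaban/b2b-balaban-ref1/pages/1982-cmp86-higgs23-II/1982-cmp86-higgs23-II-p011-x2.png` (+ the
OCR text layer for the set subscripts of (2.37)); part I [Balaban1982Higgs1] Prop. 2.3 pp. 611–612 [PDF 9–10].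

CITATION HEADER — WHAT IS REPRODUCED.  SKELETON row **B2.Eq2.42** ((2.20)–(2.42)), member **(2.36)** p. 565 (this file)
and the engines for member **(2.37)** (`…B2Eq237FormSplit`); the scalar twins (2.38)–(2.40) are a further sequel.  Unit `lit-balaban-p15` gen 3
(Phase-2 proof seat p15; HOME `run/shared/lean/pub/lit-balaban/`, seat dir `lit-balaban-p15/`); B2 fold owner r02, second
reader r14; referee ref-4.  Inputs by name: r02's (2.27) operator `B2Eq224FirstStepFields.delta227` and boundary sum
`bdry226` (p248319), `B2Eq218Translation.restrict`; p23 g4's decay engines `B2Lemma25Proof.far_sum_bound` /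
`damped_sum_bound` (p247392); r14's `B2StepK.rDecayBeatsPowers` ((2.109) "arbitrary κ", p240722); the step-k analogue
(2.47) where the `O((L^{k−1}ε)^κ)|Λ₆|` term is a HYPOTHESIS is r14 g4's `B2Sect2BDensities.eq247_of_replacements` (p248067).

WHAT IS PRINTED (p. 565 [PDF 11], verbatim).  *"The second representation in (2.34) was obtained by integration with
respect to A↾_{Λ₅}, φ↾_{Λ₅}. We will transform it further in order to get the same representation as in Chap. I.3, when the
fields B, ψ are restricted to the set Λ₆. We have
aL⁻²Σ_{b∈st(Λ₅)} A(b₊)·(C^{(0)}_{Λ₅}Q*B)(b₋) = aL⁻²Σ_{b∈st(Λ₅)} A(b₊)·(C^{(0)}_{Λ₅}Q*Λ′₆ᶜB)(b₋) + O(ε^κ)|∂Λ₅|,   (2.36)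
½⟨B, Δ^{(1),L}_{Λ₅}B⟩ = ½⟨Λ′₆ᶜB, Δ^{(1),L}_{Λ₅}Λ′₆ᶜB⟩ − a²L⁻⁴⟨(Λ′₅∩Λ′₆ᶜ)B, QC^{(0)}_{Λ₅}Q*(Λ′₆∩Λ′₇ᶜ)B⟩
  + ½⟨Λ′₆B, Δ^{(1),L}Λ′₆B⟩ + O(ε^κ)|Λ′₅|,   (2.37)  for arbitrary κ."*  (The unsubscripted Δ^{(1),L} in the third term of
(2.37) is the whole-lattice operator (2.27) with C^{(0)} in place of C^{(0)}_{Λ₅}.)  The inputs, part I Prop. 2.3 p. 611,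
verbatim: *"|C^{(k)}_Λ(Ω, A; x, x′)| ≦ c₀exp(−δ₀|x − x′|), x, x′ ∈ Λ. (2.34) … Putting δC^{(k)}_Λ(Ω, A) = C^{(k)}_Λ(Ω, A) −
C^{(k)}(Ω, A), (2.35) we have |δC^{(k)}_Λ(Ω, A; x, x′)| ≦ c₀exp(−δ₀(|x − x′| + dist(x, Λᶜ) + dist(x′, Λᶜ))), x, x′ ∈ Λ.
(2.36)"*, and the geometry (2.8) p. 558: *"Λ_{i+1}ᶜ is the sum of all large blocks of T₁ with distances from the set Λ_iᶜ
less or equal r(ε)"*, r(ε) = R(1 + log ε⁻¹)^r, r > 1 (2.7); the thresholds (2.2)/(2.17): |A|, |B| ≦ p(ε)/(μ₀ε) outside the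
large-field regions, p(ε) = b₀(1 + log ε⁻¹)^p.

DICTIONARY = r02's `…B2Eq224FirstStepFields` (plain real coordinates): `X` ↤ components of the unit-lattice fields on `T₁`,
`Y` ↤ components of the block fields; `Q : Matrix Y X ℝ` ↤ the block averaging, `Qs : Matrix X Y ℝ` ↤ `Q*` with `Qs = w·Qᵀ`
(`hQs`, `w` ↤ `L^d` the weight of `⟨·,·⟩_{T′₁}`, so `⟨u, Kv⟩_{T′₁} = w·(u ⬝ᵥ Kv)`); `c` ↤ `aL⁻²` (`c²` ↤ `a²L⁻⁴`);
`D : Matrix X X ℝ` ↤ `−Δ + μ₀²ε²` (its off-diagonal entry `D x x′ = −1` exactly on bonds; `st(Λ₅)` = the pairs `x ∉ Λ₅`, `x′ ∈ Λ₅`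
with `D x x′ ≠ 0`; `bdrySize Λ D = Σ_{x′∈Λ}Σ_{x∉Λ}|D x x′|` = the number of boundary bonds ↤ the printed `|∂Λ₅|` up to the factor
`2d`); `Λ : Finset X` ↤ `Λ₅`, `Λ' : Finset Y` ↤ `Λ′₅` (*"union of big blocks"*: `hQ : Q y x ≠ 0 → (x ∈ Λ ↔ y ∈ Λ′)`),
`Λ₆' ⊆ Λ'` ↤ `Λ′₆`, `Λ₇' ⊆ Λ₆'` ↤ `Λ′₇`; `CΛ : Matrix X X ℝ` ↤ `C^{(0)}_{Λ₅}` extended by zero (`hCs`), `C` ↤ `C^{(0)}`;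
`restrict Λ₆' B` ↤ `Λ′₆B`, `B − restrict Λ₆' B` ↤ `Λ′₆ᶜB`; `d x x′` ↤ `|x − x′|`, `u x` ↤ `dist(x, Λ₅ᶜ)`; the DECAY SHAPES
(I.2.34)/(I.2.36) are hypotheses on the kernels (`hK`, `hδC`), exactly as in p23's Lemma 2.5 file; the SEPARATION of (2.8)
is the hypothesis `R ≤ d x x″` between the supports named in each display (`hsep…`); `Ssum` ↤ a bound for
`Σ_{x″}e^{−½δ₀|x′−x″|}` (on ℤ^ν: `B2Lemma25Proof.sum_exp_neg_l1dist_le`); `q₁`, `qs₁` ↤ bounds for the row sums `Σ_x|Q y x|`,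
`Σ_y|Qs x y|` (`= 1` for the block mean and its 0/1 adjoint kernel); `GA`, `GB` ↤ the thresholds for `|A|` on `∂Λ₅` and
`|B|` on `Λ′₅`.

WHAT IS KERNEL-CHECKED (zero `sorry`, standard axioms, no `Prop`-valued definition; two plain `def`s `bdryWeight`, `bdrySize`).
 §0 `pFn_le_rpow` (`p(ℓ) ≤ b₀ℓ^{−p}` on `(0,1]`) and `decay_thresholds_pow` (*"arbitrary κ"*: `e^{−a·r(ℓ)}·(p(ℓ)/(μ₀ℓ))² ≤
    C_κℓ^κ` for every real κ, from `rDecayBeatsPowers`); §1 two bilinear decay engines on top of p23's: `bilin_far_bound`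
    (far-separated supports, (I.2.34)) and `bilin_damped_bound` (doubly-damped kernel difference, (I.2.36));
 §2 **(2.36)**: `bdry226_eq_sum_weight` (the boundary sum as a kernel sum), `bdry226_add` (linearity), `eq236_exact` (left
    side = right side + the far term `bdry226 … (Λ′₆B)`), **`eq236_error_bound`** (`|far term| ≤
    |c|·GA·bdrySize·c₀e^{−½δ₀R}·qs₁GB·Ssum`), **`eq236_error_pow`** (`≤ |c|c₀qs₁Ssum·C_κℓ^κ·bdrySize` under the printed thresholds
    `|A|, |B| ≤ p(ℓ)/(μ₀ℓ)` and `R ≥ r(ℓ)`).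
HONEST SCOPE.  The operators are data carrying the printed structural facts as hypotheses (adjointness `hQs`, block
structure `hQ`, Dirichlet support `hCs`, symmetry of `C^{(0)}_{Λ₅}`, the decay (I.2.34)/(I.2.36), the separation (2.8));
the identification `bdrySize ≍ |∂Λ₅|` is up to the lattice constant `2d`; nothing about the functional integral (2.33).
-/

namespace Literature.MathematicalPhysics.QuantumFieldTheory.Balaban1983to89.B2Eq236Replacements

open Real Matrix
open B2Eq218Translation (restrict)
open B2Eq224FirstStepFields (delta227 bdry226)
open B2Lemma25Proof (far_sum_bound damped_sum_bound)

/-! ## §0 The thresholds against the decay: `p(ℓ) ≤ b₀ℓ^{−p}` and *"arbitrary κ"* -/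

/-- `p(ℓ) = b₀(1 + log ℓ⁻¹)^p ≤ b₀ℓ^{−p}` for `0 < ℓ ≤ 1` (`1 + log ℓ⁻¹ ≤ ℓ⁻¹`). [cite: Balaban1982Higgs2, (2.3) p.557] -/
theorem pFn_le_rpow {b₀ p ℓ : ℝ} (hb : 0 ≤ b₀) (hp : 0 ≤ p) (hℓ : 0 < ℓ) (hℓ1 : ℓ ≤ 1) :
    B2.pFn b₀ p ℓ ≤ b₀ * ℓ ^ (-p) := by
  unfold B2.pFn
  have hlog : 0 ≤ Real.log ℓ⁻¹ := by
    rw [Real.log_inv]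
    have := Real.log_nonpos hℓ.le hℓ1
    linarith
  have h1 : 1 + Real.log ℓ⁻¹ ≤ ℓ⁻¹ := by
    have h := Real.add_one_le_exp (Real.log ℓ⁻¹)
    rw [Real.exp_log (inv_pos.2 hℓ)] at h
    linarith
  have h2 : (1 + Real.log ℓ⁻¹) ^ p ≤ (ℓ⁻¹) ^ p := Real.rpow_le_rpow (by linarith) h1 hp
  have h3 : (ℓ⁻¹) ^ p = ℓ ^ (-p) := by rw [Real.inv_rpow hℓ.le, Real.rpow_neg hℓ.le]
  calc b₀ * (1 + Real.log ℓ⁻¹) ^ p ≤ b₀ * (ℓ⁻¹) ^ p := mul_le_mul_of_nonneg_left h2 hb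
    _ = b₀ * ℓ ^ (-p) := by rw [h3]

/-- `p(ℓ) ≥ 0`. [cite: Balaban1982Higgs2, (2.3) p.557] -/
theorem pFn_nonneg {b₀ p ℓ : ℝ} (hb : 0 ≤ b₀) (hℓ : 0 < ℓ) (hℓ1 : ℓ ≤ 1) : 0 ≤ B2.pFn b₀ p ℓ := by
  unfold B2.pFn
  have hlog : 0 ≤ Real.log ℓ⁻¹ := by
    rw [Real.log_inv]
    have := Real.log_nonpos hℓ.le hℓ1
    linarith
  exact mul_nonneg hb (Real.rpow_nonneg (by linarith) _)

/-- **"for arbitrary κ"** (p. 565): the decay `e^{−a·r(ℓ)}` beats the thresholds — for `a > 0`, the printed ranges `R > 0`,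
`r > 1` of (2.7), `b₀ ≥ 0`, `p ≥ 0`, `μ₀ > 0` and every real `κ` there is `C ≥ 0` with
`e^{−a·r(ℓ)}·(p(ℓ)/(μ₀ℓ))² ≤ C·ℓ^κ` for all `ℓ ∈ (0,1]` (`r14`'s `rDecayBeatsPowers` at the exponent `κ + 2p + 2` and
`pFn_le_rpow`). [cite: Balaban1982Higgs2, (2.36)–(2.37) p.565] -/
theorem decay_thresholds_pow {a Rr r b₀ p μ₀ : ℝ} (ha : 0 < a) (hR : 0 < Rr) (hr : 1 < r) (hb : 0 ≤ b₀) (hp : 0 ≤ p)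
    (hμ₀ : 0 < μ₀) (κ : ℝ) :
    ∃ C : ℝ, 0 ≤ C ∧ ∀ ℓ : ℝ, 0 < ℓ → ℓ ≤ 1 →
      Real.exp (-(a * B2.rFn Rr r ℓ)) * (B2.pFn b₀ p ℓ / (μ₀ * ℓ)) ^ 2 ≤ C * ℓ ^ κ := by
  obtain ⟨C₀, hC₀⟩ := B2StepK.rDecayBeatsPowers ha hR hr (κ + 2 * p + 2)
  refine ⟨max C₀ 0 * (b₀ / μ₀) ^ 2, by positivity, fun ℓ hℓ hℓ1 => ?_⟩
  have hexp : Real.exp (-(a * B2.rFn Rr r ℓ)) ≤ max C₀ 0 * ℓ ^ (κ + 2 * p + 2) :=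
    (hC₀ ℓ hℓ hℓ1).trans (mul_le_mul_of_nonneg_right (le_max_left _ _) (Real.rpow_nonneg hℓ.le _))
  have hthr : B2.pFn b₀ p ℓ / (μ₀ * ℓ) ≤ b₀ / μ₀ * ℓ ^ (-p - 1) := by
    rw [div_le_iff₀ (mul_pos hμ₀ hℓ)]
    have hsplit : ℓ ^ (-p - 1) * ℓ = ℓ ^ (-p) := by
      rw [← Real.rpow_add_one hℓ.ne']
      ring_nf
    calc B2.pFn b₀ p ℓ ≤ b₀ * ℓ ^ (-p) := pFn_le_rpow hb hp hℓ hℓ1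
      _ = b₀ / μ₀ * ℓ ^ (-p - 1) * (μ₀ * ℓ) := by
          rw [← hsplit]
          field_simp
  have hthr0 : 0 ≤ B2.pFn b₀ p ℓ / (μ₀ * ℓ) := div_nonneg (pFn_nonneg hb hℓ hℓ1) (mul_pos hμ₀ hℓ).le
  have hsq : (B2.pFn b₀ p ℓ / (μ₀ * ℓ)) ^ 2 ≤ (b₀ / μ₀) ^ 2 * ℓ ^ (-(2 * p) - 2) := by
    have h1 : (B2.pFn b₀ p ℓ / (μ₀ * ℓ)) ^ 2 ≤ (b₀ / μ₀ * ℓ ^ (-p - 1)) ^ 2 := pow_le_pow_left₀ hthr0 hthr 2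
    have h2 : (b₀ / μ₀ * ℓ ^ (-p - 1)) ^ 2 = (b₀ / μ₀) ^ 2 * ℓ ^ (-(2 * p) - 2) := by
      have h3 : (ℓ ^ (-p - 1)) ^ 2 = ℓ ^ (-(2 * p) - 2) := by
        rw [← Real.rpow_natCast, ← Real.rpow_mul hℓ.le]
        congr 1
        push_cast
        ring
      rw [mul_pow, h3]
    rw [← h2]
    exact h1
  calc Real.exp (-(a * B2.rFn Rr r ℓ)) * (B2.pFn b₀ p ℓ / (μ₀ * ℓ)) ^ 2
      ≤ (max C₀ 0 * ℓ ^ (κ + 2 * p + 2)) * ((b₀ / μ₀) ^ 2 * ℓ ^ (-(2 * p) - 2)) :=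
        mul_le_mul hexp hsq (sq_nonneg _) (by positivity)
    _ = max C₀ 0 * (b₀ / μ₀) ^ 2 * (ℓ ^ (κ + 2 * p + 2) * ℓ ^ (-(2 * p) - 2)) := by ring
    _ = max C₀ 0 * (b₀ / μ₀) ^ 2 * ℓ ^ κ := by
        rw [← Real.rpow_add hℓ]
        ring_nf

/-! ## §1 Bilinear decay engines (on top of `B2Lemma25Proof`) -/

section Engine

variable {X : Type*}

/-- The triangle inequality for a weighted sum of kernel sums. [folklore] [cite: Balaban1982Higgs2, (2.36) p.565] -/
theorem abs_bilin_le (S₁ S₂ : Finset X) (f g : X → ℝ) (K : X → X → ℝ) :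
    |∑ x ∈ S₁, ∑ x' ∈ S₂, f x * K x x' * g x'| ≤ ∑ x ∈ S₁, |f x| * |∑ x' ∈ S₂, K x x' * g x'| := by
  have h : ∀ x ∈ S₁, ∑ x' ∈ S₂, f x * K x x' * g x' = f x * ∑ x' ∈ S₂, K x x' * g x' := by
    intro x _
    rw [Finset.mul_sum]
    exact Finset.sum_congr rfl fun x' _ => by ring
  rw [Finset.sum_congr rfl h]
  refine (Finset.abs_sum_le_sum_abs _ _).trans (le_of_eq ?_)
  exact Finset.sum_congr rfl fun x _ => abs_mul _ _

/-- **FAR bilinear engine** ((I.2.34) + separation): if `|K(x,x′)| ≤ c₀e^{−δd(x,x′)}`, the supports of `f` and `g` are `≥ R`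
apart, `|g| ≤ G`, `Σ_x|f x| ≤ F` and `Σ_{x′}e^{−½δd(x,x′)} ≤ Ssum` (`Ssum ≥ 0`), then
`|Σ_xΣ_{x′} f(x)K(x,x′)g(x′)| ≤ F·c₀e^{−½δR}·G·Ssum`. [cite: Balaban1982Higgs2, (2.36) p.565] -/
theorem bilin_far_bound {S₁ S₂ : Finset X} {f g : X → ℝ} {K d : X → X → ℝ} {c₀ δ R G F Ssum : ℝ}
    (hc₀ : 0 ≤ c₀) (hδ : 0 ≤ δ) (hG : 0 ≤ G) (hF : ∑ x ∈ S₁, |f x| ≤ F)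
    (hK : ∀ x ∈ S₁, ∀ x' ∈ S₂, |K x x'| ≤ c₀ * Real.exp (-(δ * d x x')))
    (hfar : ∀ x ∈ S₁, ∀ x' ∈ S₂, f x ≠ 0 → g x' ≠ 0 → R ≤ d x x')
    (hg : ∀ x' ∈ S₂, |g x'| ≤ G) (hS0 : 0 ≤ Ssum)
    (hS : ∀ x ∈ S₁, ∑ x' ∈ S₂, Real.exp (-(δ / 2 * d x x')) ≤ Ssum) :
    |∑ x ∈ S₁, ∑ x' ∈ S₂, f x * K x x' * g x'| ≤ F * (c₀ * Real.exp (-(δ / 2 * R)) * G * Ssum) := by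
  have hterm : ∀ x ∈ S₁, |f x| * |∑ x' ∈ S₂, K x x' * g x'|
      ≤ |f x| * (c₀ * Real.exp (-(δ / 2 * R)) * G * Ssum) := by
    intro x hx
    by_cases hfx : f x = 0
    · rw [hfx, abs_zero, zero_mul, zero_mul]
    · refine mul_le_mul_of_nonneg_left ?_ (abs_nonneg _)
      exact far_sum_bound hc₀ hδ hG (hK x hx) (fun x' hx' hg' => hfar x hx x' hx' hfx hg') hg (hS x hx)
  calc |∑ x ∈ S₁, ∑ x' ∈ S₂, f x * K x x' * g x'|
      ≤ ∑ x ∈ S₁, |f x| * |∑ x' ∈ S₂, K x x' * g x'| := abs_bilin_le S₁ S₂ f g K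
    _ ≤ ∑ x ∈ S₁, |f x| * (c₀ * Real.exp (-(δ / 2 * R)) * G * Ssum) := Finset.sum_le_sum hterm
    _ = (∑ x ∈ S₁, |f x|) * (c₀ * Real.exp (-(δ / 2 * R)) * G * Ssum) := by rw [Finset.sum_mul]
    _ ≤ F * (c₀ * Real.exp (-(δ / 2 * R)) * G * Ssum) := mul_le_mul_of_nonneg_right hF (by positivity)


/-- **DAMPED bilinear engine** ((I.2.36)): if `|D(x,x′)| ≤ c₀e^{−δ(d(x,x′) + u(x) + u(x′))}` on `S₁ × S₂` with `u ≥ R` on the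
support of `f`, `u ≥ 0` on `S₂`, `d ≥ 0`, `|g| ≤ G`, `Σ_x|f x| ≤ F`, `Σ_{x′}e^{−½δd(x,x′)} ≤ Ssum` (`Ssum ≥ 0`), then
`|Σ_xΣ_{x′} f(x)D(x,x′)g(x′)| ≤ F·c₀e^{−δR}·G·Ssum`. [cite: Balaban1982Higgs2, (2.37) p.565] -/
theorem bilin_damped_bound {S₁ S₂ : Finset X} {f g : X → ℝ} {Dk d : X → X → ℝ} {u : X → ℝ}
    {c₀ δ R G F Ssum : ℝ} (hc₀ : 0 ≤ c₀) (hδ : 0 ≤ δ) (hG : 0 ≤ G) (hF : ∑ x ∈ S₁, |f x| ≤ F)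
    (hD : ∀ x ∈ S₁, ∀ x' ∈ S₂, |Dk x x'| ≤ c₀ * Real.exp (-(δ * (d x x' + u x + u x'))))
    (hu : ∀ x ∈ S₁, f x ≠ 0 → R ≤ u x) (hu' : ∀ x' ∈ S₂, 0 ≤ u x') (hd : ∀ x ∈ S₁, ∀ x' ∈ S₂, 0 ≤ d x x')
    (hg : ∀ x' ∈ S₂, |g x'| ≤ G) (hS0 : 0 ≤ Ssum)
    (hS : ∀ x ∈ S₁, ∑ x' ∈ S₂, Real.exp (-(δ / 2 * d x x')) ≤ Ssum) :
    |∑ x ∈ S₁, ∑ x' ∈ S₂, f x * Dk x x' * g x'| ≤ F * (c₀ * Real.exp (-(δ * R)) * G * Ssum) := by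
  have hterm : ∀ x ∈ S₁, |f x| * |∑ x' ∈ S₂, Dk x x' * g x'|
      ≤ |f x| * (c₀ * Real.exp (-(δ * R)) * G * Ssum) := by
    intro x hx
    by_cases hfx : f x = 0
    · rw [hfx, abs_zero, zero_mul, zero_mul]
    · refine mul_le_mul_of_nonneg_left ?_ (abs_nonneg _)
      exact damped_sum_bound (u' := u) hc₀ hδ hG (hu x hx hfx) hu' (hd x hx) (hD x hx) hg (hS x hx)
  calc |∑ x ∈ S₁, ∑ x' ∈ S₂, f x * Dk x x' * g x'|
      ≤ ∑ x ∈ S₁, |f x| * |∑ x' ∈ S₂, Dk x x' * g x'| := abs_bilin_le S₁ S₂ f g Dk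
    _ ≤ ∑ x ∈ S₁, |f x| * (c₀ * Real.exp (-(δ * R)) * G * Ssum) := Finset.sum_le_sum hterm
    _ = (∑ x ∈ S₁, |f x|) * (c₀ * Real.exp (-(δ * R)) * G * Ssum) := by rw [Finset.sum_mul]
    _ ≤ F * (c₀ * Real.exp (-(δ * R)) * G * Ssum) := mul_le_mul_of_nonneg_right hF (by positivity)

end Engine

/-! ## §2 **(2.36)**: restricting `B` to `Λ′₆ᶜ` in the boundary term costs `O(ε^κ)|∂Λ₅|` -/

section Vector

variable {X Y : Type*} [Fintype X] [Fintype Y] [DecidableEq X] [DecidableEq Y]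

/-- The weight of an inner boundary point: `a(x′) = Σ_{x∉Λ₅} A(x)·(−D x x′)` — for the nearest-neighbour `−Δ` the sum of
`A(b₊)` over the bonds `b ∈ st(Λ₅)` with `b₋ = x′`. [cite: Balaban1982Higgs2, (2.36) p.565] -/
def bdryWeight (Λ : Finset X) (D : Matrix X X ℝ) (A : X → ℝ) (x' : X) : ℝ := ∑ x ∈ Λᶜ, A x * (-D x x')

/-- The size of the boundary through the couplings: `Σ_{x′∈Λ₅}Σ_{x∉Λ₅}|D x x′|` — for the nearest-neighbour `−Δ` the number
of bonds in `st(Λ₅)` (`≤ 2d·|∂Λ₅|`), the volume factor `|∂Λ₅|` of (2.36). [cite: Balaban1982Higgs2, (2.36) p.565] -/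
def bdrySize (Λ : Finset X) (D : Matrix X X ℝ) : ℝ := ∑ x' ∈ Λ, ∑ x ∈ Λᶜ, |D x x'|

omit [DecidableEq Y] in
/-- The boundary term of (2.26)/(2.34) as a bilinear kernel sum: `bdry226 = c·Σ_{x′∈Λ}Σ_{x″} a(x′)·C_Λ(x′,x″)·(Q*ψ)(x″)`.
[cite: Balaban1982Higgs2, (2.36) p.565] -/
theorem bdry226_eq_sum_weight (c : ℝ) (Λ : Finset X) (D CΛ : Matrix X X ℝ) (Qs : Matrix X Y ℝ) (A : X → ℝ)
    (ψ : Y → ℝ) :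
    bdry226 c Λ D CΛ Qs A ψ
      = c * ∑ x' ∈ Λ, ∑ x'' : X, bdryWeight Λ D A x' * CΛ x' x'' * (Qs *ᵥ ψ) x'' := by
  unfold bdry226 bdryWeight
  congr 1
  rw [Finset.sum_comm]
  refine Finset.sum_congr rfl fun x' _ => ?_
  calc ∑ x ∈ Λᶜ, A x * -D x x' * (CΛ *ᵥ (Qs *ᵥ ψ)) x'
      = (∑ x ∈ Λᶜ, A x * -D x x') * (CΛ *ᵥ (Qs *ᵥ ψ)) x' := by rw [Finset.sum_mul]
    _ = (∑ x ∈ Λᶜ, A x * -D x x') * ∑ x'', CΛ x' x'' * (Qs *ᵥ ψ) x'' := rfl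
    _ = ∑ x'', (∑ x ∈ Λᶜ, A x * -D x x') * CΛ x' x'' * (Qs *ᵥ ψ) x'' := by
        rw [Finset.mul_sum]
        exact Finset.sum_congr rfl fun _ _ => by ring

omit [DecidableEq Y] in
/-- The boundary term is linear in the block field. [cite: Balaban1982Higgs2, (2.36) p.565] -/
theorem bdry226_add (c : ℝ) (Λ : Finset X) (D CΛ : Matrix X X ℝ) (Qs : Matrix X Y ℝ) (A : X → ℝ) (ψ₁ ψ₂ : Y → ℝ) :
    bdry226 c Λ D CΛ Qs A (ψ₁ + ψ₂) = bdry226 c Λ D CΛ Qs A ψ₁ + bdry226 c Λ D CΛ Qs A ψ₂ := by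
  unfold bdry226
  rw [← mul_add, ← Finset.sum_add_distrib]
  congr 1
  refine Finset.sum_congr rfl fun x _ => ?_
  rw [← Finset.sum_add_distrib]
  refine Finset.sum_congr rfl fun x' _ => ?_
  rw [mulVec_add, mulVec_add, Pi.add_apply]
  ring

/-- **(2.36), the exact part**: `aL⁻²Σ_{b∈st(Λ₅)} A(b₊)(C^{(0)}_{Λ₅}Q*B)(b₋) = aL⁻²Σ_{b∈st(Λ₅)} A(b₊)(C^{(0)}_{Λ₅}Q*Λ′₆ᶜB)(b₋) +
[the same with Λ′₆B]` — the last summand is the printed `O(ε^κ)|∂Λ₅|` (`eq236_error_bound`). [cite: Balaban1982Higgs2, (2.36) p.565] -/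
theorem eq236_exact (c : ℝ) (Λ : Finset X) (D CΛ : Matrix X X ℝ) (Qs : Matrix X Y ℝ) (A : X → ℝ) (B : Y → ℝ)
    (Λ₆' : Finset Y) :
    bdry226 c Λ D CΛ Qs A B
      = bdry226 c Λ D CΛ Qs A (B - restrict Λ₆' B) + bdry226 c Λ D CΛ Qs A (restrict Λ₆' B) := by
  rw [← bdry226_add, sub_add_cancel]

omit [Fintype X] [Fintype Y] [DecidableEq X] in
/-- `|Λ′₆B| ≤ GB` everywhere if `|B| ≤ GB` on `Λ′₆` (`GB ≥ 0`). [folklore] [cite: Balaban1982Higgs2, (2.17) p.560] -/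
theorem abs_restrict_le {Λ₆' : Finset Y} {B : Y → ℝ} {GB : ℝ} (hGB : 0 ≤ GB) (hB : ∀ y ∈ Λ₆', |B y| ≤ GB) (y : Y) :
    |restrict Λ₆' B y| ≤ GB := by
  unfold restrict
  split_ifs with hy
  · exact hB y hy
  · rw [abs_zero]; exact hGB

omit [Fintype X] [DecidableEq X] in
/-- `|(Q*Λ′₆B)(x″)| ≤ (Σ_y|Q*(x″,y)|)·GB ≤ qs₁·GB`. [folklore] [cite: Balaban1982Higgs2, (2.36) p.565] -/
theorem abs_Qs_restrict_le {Qs : Matrix X Y ℝ} {Λ₆' : Finset Y} {B : Y → ℝ} {GB qs₁ : ℝ} (hGB : 0 ≤ GB)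
    (hB : ∀ y ∈ Λ₆', |B y| ≤ GB) (hQs1 : ∀ x'', ∑ y, |Qs x'' y| ≤ qs₁) (x'' : X) :
    |(Qs *ᵥ restrict Λ₆' B) x''| ≤ qs₁ * GB := by
  calc |(Qs *ᵥ restrict Λ₆' B) x''| = |∑ y, Qs x'' y * restrict Λ₆' B y| := rfl
    _ ≤ ∑ y, |Qs x'' y * restrict Λ₆' B y| := Finset.abs_sum_le_sum_abs _ _
    _ ≤ ∑ y, |Qs x'' y| * GB := Finset.sum_le_sum fun y _ => by
        rw [abs_mul]
        exact mul_le_mul_of_nonneg_left (abs_restrict_le hGB hB y) (abs_nonneg _)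
    _ = (∑ y, |Qs x'' y|) * GB := by rw [Finset.sum_mul]
    _ ≤ qs₁ * GB := mul_le_mul_of_nonneg_right (hQs1 x'') hGB

omit [Fintype X] [DecidableEq X] in
/-- A point where `Q*Λ′₆B` is nonzero lies in a block of `Λ′₆`. [folklore] [cite: Balaban1982Higgs2, (2.36) p.565] -/
theorem exists_of_Qs_restrict_ne_zero {Qs : Matrix X Y ℝ} {Λ₆' : Finset Y} {B : Y → ℝ} {x'' : X}
    (h : (Qs *ᵥ restrict Λ₆' B) x'' ≠ 0) : ∃ y ∈ Λ₆', Qs x'' y ≠ 0 := by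
  have h' : (∑ y, Qs x'' y * restrict Λ₆' B y) ≠ 0 := h
  obtain ⟨y, -, hy⟩ := Finset.exists_ne_zero_of_sum_ne_zero h'
  have hyQ : Qs x'' y ≠ 0 := fun h0 => hy (by rw [h0, zero_mul])
  refine ⟨y, ?_, hyQ⟩
  by_contra hy6
  apply hy
  rw [show restrict Λ₆' B y = 0 from if_neg hy6, mul_zero]

omit [Fintype Y] [DecidableEq Y] in
/-- `Σ_{x′∈Λ₅}|a(x′)| ≤ GA·bdrySize` when `|A| ≤ GA` at the outer endpoints of the boundary couplings.
[cite: Balaban1982Higgs2, (2.36) p.565] -/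
theorem sum_abs_bdryWeight_le {Λ : Finset X} {D : Matrix X X ℝ} {A : X → ℝ} {GA : ℝ}
    (hA : ∀ x ∉ Λ, ∀ x' ∈ Λ, D x x' ≠ 0 → |A x| ≤ GA) :
    ∑ x' ∈ Λ, |bdryWeight Λ D A x'| ≤ GA * bdrySize Λ D := by
  unfold bdrySize bdryWeight
  rw [Finset.mul_sum]
  refine Finset.sum_le_sum fun x' hx' => ?_
  calc |∑ x ∈ Λᶜ, A x * -D x x'| ≤ ∑ x ∈ Λᶜ, |A x * -D x x'| := Finset.abs_sum_le_sum_abs _ _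
    _ ≤ ∑ x ∈ Λᶜ, GA * |D x x'| := Finset.sum_le_sum fun x hx => by
        rw [abs_mul, abs_neg]
        by_cases hD : D x x' = 0
        · rw [hD, abs_zero, mul_zero, mul_zero]
        · exact mul_le_mul_of_nonneg_right (hA x (Finset.mem_compl.1 hx) x' hx' hD) (abs_nonneg _)
    _ = GA * ∑ x ∈ Λᶜ, |D x x'| := by rw [Finset.mul_sum]

/-- **(2.36), the error**: *"+ O(ε^κ)|∂Λ₅|"* — with (I.2.34) for `C^{(0)}_{Λ₅}` (`hK`, the zero-extended kernel), the
threshold `GA` for `|A|` at the outer endpoints of `st(Λ₅)` (*"the fields A′, φ′ are small on ∂Λ₅"*; here the restrictions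
on `A` on `Λ₋₁∩Λ₅ᶜ`), `GB` for `|B|` on `Λ′₆`, the row-sum bound `qs₁` of `Q*`, the summability constant `Ssum`, and the
separation `R` between the inner endpoints of `st(Λ₅)` and the blocks of `Λ′₆` ((2.8): farther than `r(ε)` up to a lattice
constant): `|aL⁻²Σ_{b∈st(Λ₅)}A(b₊)(C^{(0)}_{Λ₅}Q*Λ′₆B)(b₋)| ≤ |c|·GA·bdrySize·c₀e^{−½δ₀R}·qs₁GB·Ssum`.
[cite: Balaban1982Higgs2, (2.36) p.565] -/
theorem eq236_error_bound {c : ℝ} {Λ : Finset X} {D CΛ : Matrix X X ℝ} {Qs : Matrix X Y ℝ} {A : X → ℝ} {B : Y → ℝ}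
    {Λ₆' : Finset Y} {d : X → X → ℝ} {c₀ δ R GA GB qs₁ Ssum : ℝ}
    (hc₀ : 0 ≤ c₀) (hδ : 0 ≤ δ) (hGB : 0 ≤ GB) (hqs : 0 ≤ qs₁) (hS0 : 0 ≤ Ssum)
    (hK : ∀ x' x'', |CΛ x' x''| ≤ c₀ * Real.exp (-(δ * d x' x'')))
    (hA : ∀ x ∉ Λ, ∀ x' ∈ Λ, D x x' ≠ 0 → |A x| ≤ GA) (hB : ∀ y ∈ Λ₆', |B y| ≤ GB)
    (hQs1 : ∀ x'', ∑ y, |Qs x'' y| ≤ qs₁)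
    (hsep : ∀ x x' x'' y, x ∉ Λ → x' ∈ Λ → D x x' ≠ 0 → y ∈ Λ₆' → Qs x'' y ≠ 0 → R ≤ d x' x'')
    (hS : ∀ x', ∑ x'', Real.exp (-(δ / 2 * d x' x'')) ≤ Ssum) :
    |bdry226 c Λ D CΛ Qs A (restrict Λ₆' B)|
      ≤ |c| * ((GA * bdrySize Λ D) * (c₀ * Real.exp (-(δ / 2 * R)) * (qs₁ * GB) * Ssum)) := by
  rw [bdry226_eq_sum_weight, abs_mul]
  refine mul_le_mul_of_nonneg_left ?_ (abs_nonneg c)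
  refine bilin_far_bound (S₁ := Λ) (S₂ := Finset.univ) hc₀ hδ (mul_nonneg hqs hGB) (sum_abs_bdryWeight_le hA)
    (fun x' _ x'' _ => hK x' x'') ?_ (fun x'' _ => abs_Qs_restrict_le hGB hB hQs1 x'') hS0 (fun x' _ => hS x')
  intro x' hx' x'' _ hf hg
  obtain ⟨x, hx, hxne⟩ := Finset.exists_ne_zero_of_sum_ne_zero hf
  have hD : D x x' ≠ 0 := by
    intro h0
    apply hxne
    rw [h0, neg_zero, mul_zero]
  obtain ⟨y, hy6, hyQ⟩ := exists_of_Qs_restrict_ne_zero hg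
  exact hsep x x' x'' y (Finset.mem_compl.1 hx) hx' hD hy6 hyQ

/-- **(2.36), "for arbitrary κ"**: with the printed thresholds `GA = GB = p(ℓ)/(μ₀ℓ)` ((2.2)/(2.17) at scale `ℓ = ε`), the
separation `R ≥ r(ℓ)` of (2.8) and the constant `C_κ` of `decay_thresholds_pow` (rate `½δ₀`), the error of (2.36) is
`≤ |c|·c₀·qs₁·Ssum·C_κ·ℓ^κ·bdrySize` — *"O(ε^κ)|∂Λ₅|"*. [cite: Balaban1982Higgs2, (2.36) p.565] -/
theorem eq236_error_pow {c : ℝ} {Λ : Finset X} {D CΛ : Matrix X X ℝ} {Qs : Matrix X Y ℝ} {A : X → ℝ} {B : Y → ℝ}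
    {Λ₆' : Finset Y} {d : X → X → ℝ} {c₀ δ R qs₁ Ssum b₀ p μ₀ Rr r ℓ κ Cκ : ℝ}
    (hc₀ : 0 ≤ c₀) (hδ : 0 ≤ δ) (hqs : 0 ≤ qs₁) (hS0 : 0 ≤ Ssum) (hb : 0 ≤ b₀) (hμ₀ : 0 < μ₀)
    (hℓ : 0 < ℓ) (hℓ1 : ℓ ≤ 1) (hRr : B2.rFn Rr r ℓ ≤ R)
    (hCκ : Real.exp (-(δ / 2 * B2.rFn Rr r ℓ)) * (B2.pFn b₀ p ℓ / (μ₀ * ℓ)) ^ 2 ≤ Cκ * ℓ ^ κ)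
    (hK : ∀ x' x'', |CΛ x' x''| ≤ c₀ * Real.exp (-(δ * d x' x'')))
    (hA : ∀ x ∉ Λ, ∀ x' ∈ Λ, D x x' ≠ 0 → |A x| ≤ B2.pFn b₀ p ℓ / (μ₀ * ℓ))
    (hB : ∀ y ∈ Λ₆', |B y| ≤ B2.pFn b₀ p ℓ / (μ₀ * ℓ)) (hQs1 : ∀ x'', ∑ y, |Qs x'' y| ≤ qs₁)
    (hsep : ∀ x x' x'' y, x ∉ Λ → x' ∈ Λ → D x x' ≠ 0 → y ∈ Λ₆' → Qs x'' y ≠ 0 → R ≤ d x' x'')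
    (hS : ∀ x', ∑ x'', Real.exp (-(δ / 2 * d x' x'')) ≤ Ssum) :
    |bdry226 c Λ D CΛ Qs A (restrict Λ₆' B)| ≤ |c| * c₀ * qs₁ * Ssum * (Cκ * ℓ ^ κ) * bdrySize Λ D := by
  set t : ℝ := B2.pFn b₀ p ℓ / (μ₀ * ℓ) with ht
  have ht0 : 0 ≤ t := div_nonneg (pFn_nonneg hb hℓ hℓ1) (mul_pos hμ₀ hℓ).le
  have h1 := eq236_error_bound (c := c) (GA := t) hc₀ hδ ht0 hqs hS0 hK hA hB hQs1 hsep hS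
  have hexp : Real.exp (-(δ / 2 * R)) ≤ Real.exp (-(δ / 2 * B2.rFn Rr r ℓ)) := by
    rw [Real.exp_le_exp]
    have := mul_le_mul_of_nonneg_left hRr (by positivity : (0 : ℝ) ≤ δ / 2)
    linarith
  have hN : 0 ≤ bdrySize Λ D := Finset.sum_nonneg fun _ _ => Finset.sum_nonneg fun _ _ => abs_nonneg _
  have h2 : Real.exp (-(δ / 2 * R)) * t ^ 2 ≤ Cκ * ℓ ^ κ :=
    (mul_le_mul_of_nonneg_right hexp (sq_nonneg _)).trans hCκ
  calc |bdry226 c Λ D CΛ Qs A (restrict Λ₆' B)|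
      ≤ |c| * ((t * bdrySize Λ D) * (c₀ * Real.exp (-(δ / 2 * R)) * (qs₁ * t) * Ssum)) := h1
    _ = |c| * c₀ * qs₁ * Ssum * (Real.exp (-(δ / 2 * R)) * t ^ 2) * bdrySize Λ D := by ring
    _ ≤ |c| * c₀ * qs₁ * Ssum * (Cκ * ℓ ^ κ) * bdrySize Λ D := by
        apply mul_le_mul_of_nonneg_right _ hN
        exact mul_le_mul_of_nonneg_left h2 (by positivity)

end Vector

end Literature.MathematicalPhysics.QuantumFieldTheory.Balaban1983to89.B2Eq236Replacements
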